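import Literature.NumberTheory.Automorphic.BockleHuiIrreducibleGL3WeightProofs
import Literature.NumberTheory.Automorphic.AutomorphicInductionCuspidalProofs
import Literature.NumberTheory.Automorphic.CuspidalContragredientProofs
import Literature.NumberTheory.Automorphic.ArthurClozelCuspidalDescentIsobaric
import HarnessLib

/-!
# Isobaric rigidity at unramified places for cuspidal Borel–Jacquet data (proofs only)

Topic `NumberTheory/Automorphic`; namespace `Literature.NumberTheory.Automorphic`.  Proof file
(theorems only: no definition, no named fact, no instance, no `sorry`).

**Statement** (`CuspidalAutomorphicRepData.not_eventually_satake_eq_sum_of_JS`).  Let `π` be a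
cuspidal Borel–Jacquet datum on `GL_n(𝔸_K)` (`n ≥ 1`) and `σ₁, …, σ_k` (`k ≥ 2`) cuspidal data on
`GL_{m_i}(𝔸_K)` (`m_i ≥ 1`).  Then it is NOT the case that at almost every finite place `v` every
Satake parameter `t_{π,v}` of `π` is a union `⨆_i t_{σ_i,v}` of Satake parameters of the `σ_i`.  This is
the unramified shadow of Jacquet–Shalika's rigidity of isobaric sums (Jacquet–Shalika 1981 II,
Thm. 4.4: a cuspidal `π` is not nearly equivalent to `σ₁ ⊞ ⋯ ⊞ σ_k`, `k ≥ 2`), proved here from the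
two named facts of the tree it rests on — Arthur–Clozel, Ch. 3 (2.2) and (2.3) for Borel–Jacquet data
(`JacquetShalika1981_partialPairL_boundary_repData`, `JacquetShalika1981_partialPairL_pole_repData`),
taken as hypotheses — everything else being theorems of the tree: (2.1)
(`JacquetShalika1981_multipliable_partialPairL_repData_holds`), continuity and non-vanishing inside
`Re s > 1` (`continuousAt_and_ne_zero_partialPairL_repData`), the unitary normalisation
(`CuspidalAutomorphicRepData.exists_normalisation_L2`, Borel–Jacquet 5.7) with its Borel–Jacquet avatar
(`CuspidalAutomorphicRepGL.exists_cuspidalRepData_eventually_hasSatakeParamAt`), the contragredient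
datum (`CuspidalAutomorphicRepData.exists_contragredient_satake_holds`) and Flath's finiteness
(`hasSatakeParamAt_cofinite_holds`).

**Proof** (Arthur–Clozel, Ch. 3, proof of Thm. 4.2 (d), second paragraph, over ONE field; the
pattern of `ArthurClozelCuspidalDescentIsobaric.false_of_isobaric_weakLift_of_lift`).  Normalise
`t_{π,w} = q_w^{s₀} α₀(w)`, `t_{σ_i,w} = q_w^{s_i} α_i(w)` with unitary families (`|∏ α| = 1`); the
hypothesis reads `α₀ = ⨆_i q^{s_i - s₀} α_i` off a finite set, whence `∑_i m_i Re(s_i - s₀) = 0` and,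
for `i₀` with `Re s_{i₀}` maximal, `Re s_{i₀} ≥ Re s₀`.  With `τ` the contragredient of the unitary
avatar of `σ_{i₀}` (family `α_{i₀}⁻¹`) and `u₀ = 1 - s₀ + s_{i₀}` (`Re u₀ ≥ 1`), multiplicativity of the
Rankin–Selberg polynomial gives, for real `t > 0`,
`L^S(u₀ + t, α₀ ⊗ α_{i₀}⁻¹) = ∏_i L^S(1 + s_{i₀} - s_i + t, α_i ⊗ α_{i₀}⁻¹)`.
As `t → 0⁺` the left side has a finite limit (interior point if `Re u₀ > 1`; (2.2) if `Re u₀ = 1`,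
off `X` because `n = ∑ m_i > m_{i₀}`), every factor on the right has, after multiplication by a
suitable power `t^{e_i}`, a finite NON-ZERO limit (interior / (2.2) / (2.3); all points have
`Re ≥ 1` by maximality of `Re s_{i₀}`), and the factor `i = i₀` needs `e_{i₀} = 1` ((2.3) at `s = 1`).
So `t^E · LHS → 0` (`E ≥ 1`) while `t^E · RHS → ∏ c_i ≠ 0`: contradiction.

## References

* H. Jacquet, J. A. Shalika, *On Euler products and the classification of automorphic forms II*,
  Amer. J. Math. 103 (1981), 777–815, Prop. 3.6, Thm. 4.4. [JacquetShalikaAJM1981II]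
* J. Arthur, L. Clozel, *Simple algebras, base change, and the advanced theory of the trace
  formula*, Ann. of Math. Stud. 120 (1989), Ch. 3 §2 (2.1)–(2.3), proof of Thm. 4.2 (d),
  pp. 206–207. [ArthurClozelAMS120]
* A. Borel, H. Jacquet, *Automorphic forms and automorphic representations*, PSPM 33.1 (1979),
  4.6, 5.7. [BorelJacquetCorvallis1979]
-/

noncomputable section

open scoped Topology Classical NumberField
open NumberField IsDedekindDomain MeasureTheory Filter Polynomial

namespace Literature.NumberTheory.Automorphic

open AdelicGroupData

/-! ### Unitary Borel–Jacquet avatars -/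

section Avatar

variable {n : ℕ} {K : Type} [Field K] [NumberField K]

/-- **Unitary normalisation with a Borel–Jacquet avatar.**  For a cuspidal Borel–Jacquet datum `π`
on `GL_n(𝔸_K)` (`n ≥ 1`) there are `s ∈ ℂ`, a finite set `S` of places, a Satake family `α` off `S`
and a cuspidal datum `πᵘ` ("`π ⊗ |det|^{-s}`") such that off `S`: the Satake parameters of `π` are
exactly `q_w^{s} α(w)`, `πᵘ` has Satake parameter `α(w)`, `|∏ α(w)| = 1` and `card α(w) = n`.
Borel–Jacquet 1979, 5.7 ("`π ⊗ |det|^s` is unitary for suitable `s`"), through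
`CuspidalAutomorphicRepData.exists_normalisation_L2`,
`CuspidalAutomorphicRepGL.exists_cuspidalRepData_eventually_hasSatakeParamAt` and
`HasSatakeParameterAt.norm_prod_eq_one`. [cite: BorelJacquetCorvallis1979, 5.7] -/
theorem CuspidalAutomorphicRepData.exists_unitary_avatar [NeZero n]
    (hK : isCompact_glFiniteIntegralLevel n K) (π : CuspidalAutomorphicRepData n K hK) :
    ∃ (s : ℂ) (S : Set (HeightOneSpectrum (𝓞 K))) (α : SatakeFamily K)
      (πu : CuspidalAutomorphicRepData n K hK), S.Finite ∧
      (∀ w ∉ S, ∀ β : Multiset ℂ,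
        π.1.HasSatakeParamAt w β ↔ β = (α w).map (((w.residueCard : ℂ) ^ s) * ·)) ∧
      (∀ w ∉ S, πu.1.HasSatakeParamAt w (α w)) ∧
      (∀ w ∉ S, ‖(α w).prod‖ = 1) ∧ (∀ w ∉ S, Multiset.card (α w) = n) := by
  obtain ⟨μ, hμ⟩ := AdelicGroupData.exists_isAutomorphicMeasure_gl_holds n K
  haveI := hμ
  obtain ⟨s, P, S₁, α, hS₁, hα, hiff⟩ := CuspidalAutomorphicRepData.exists_normalisation_L2 hK μ π
  obtain ⟨πu, hπu⟩ :=
    CuspidalAutomorphicRepGL.exists_cuspidalRepData_eventually_hasSatakeParamAt hK P hα hS₁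
  rw [Filter.eventually_cofinite] at hπu
  refine ⟨s, S₁ ∪ {v | ¬ πu.1.HasSatakeParamAt v (α v)}, α, πu, hS₁.union hπu, ?_, ?_, ?_, ?_⟩
  · exact fun w hw β => hiff w (fun h => hw (Or.inl h)) β
  · exact fun w hw => not_not.mp fun h => hw (Or.inr h)
  · intro w hw
    obtain ⟨𝔫, -, -, ϖ, hSat⟩ := hα w (fun h => hw (Or.inl h))
    exact hSat.norm_prod_eq_one
  · intro w hw
    obtain ⟨𝔫, -, -, ϖ, hSat⟩ := hα w (fun h => hw (Or.inl h))
    exact hSat.card_eq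

end Avatar

/-! ### Limits of shifted partial pair `L`-functions along `t ↦ z + t`, `t → 0⁺` -/

section Limits

variable {K : Type} [Field K] [NumberField K]

/-- For `Re z ≥ 1` the path `t ↦ z + t` (`t > 0` real) runs inside `Re s > 1` and tends to `z`:
it maps `𝓝[>] 0` into the boundary filter `𝓝[Re s > 1] z` of the Jacquet–Shalika facts. [folklore] -/
theorem tendsto_ofReal_add_nhdsWithin {z : ℂ} (hz : 1 ≤ z.re) :
    Tendsto (fun t : ℝ => z + (t : ℂ)) (𝓝[>] (0 : ℝ)) (𝓝[{s : ℂ | 1 < s.re}] z) := by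
  refine tendsto_nhdsWithin_iff.2 ⟨?_, ?_⟩
  · have h : Tendsto (fun t : ℝ => z + (t : ℂ)) (𝓝 (0 : ℝ)) (𝓝 (z + ((0 : ℝ) : ℂ))) :=
      ((continuous_const.add Complex.continuous_ofReal).tendsto 0)
    rw [Complex.ofReal_zero, add_zero] at h
    exact h.mono_left nhdsWithin_le_nhds
  · filter_upwards [self_mem_nhdsWithin] with t ht
    simp only [Complex.add_re, Complex.ofReal_re]
    have ht' : (0 : ℝ) < t := ht
    linarith

/-- **One factor.**  For cuspidal Borel–Jacquet data `π₁` on `GL_a`, `π₂` on `GL_b` (`a, b ≥ 1`)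
there is a finite `S₀` such that for every finite `S ⊇ S₀`, all unitary Satake families `α`, `β` of
`π₁`, `π₂` off `S` and every `z` with `Re z ≥ 1`, some `t^e · L^S(z + t, α ⊗ β)` (`e ∈ ℕ`) has a finite
NON-ZERO limit as `t → 0⁺` — with `e = 0` unless `a = b`: the value at an interior point
(`continuousAt_and_ne_zero_partialPairL_repData`, Jacquet–Shalika I Thm. 5.3) if `Re z > 1`, the
boundary limit (2.2) (hypothesis `hJSb`) if `Re z = 1` and `z ∉ X`, the simple pole (2.3)
(hypothesis `hJSp`, `e = 1`) if `z ∈ X` (which forces `a = b`).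
[cite: ArthurClozelAMS120, Ch. 3 §2 (2.1)–(2.3)] -/
theorem exists_tendsto_pow_mul_partialPairL_ofReal_add
    (hJSb : JacquetShalika1981_partialPairL_boundary_repData)
    (hJSp : JacquetShalika1981_partialPairL_pole_repData)
    {a b : ℕ} (ha : 0 < a) (hb : 0 < b)
    {h₁ : isCompact_glFiniteIntegralLevel a K} {h₂ : isCompact_glFiniteIntegralLevel b K}
    (π₁ : CuspidalAutomorphicRepData a K h₁) (π₂ : CuspidalAutomorphicRepData b K h₂) :
    ∃ S₀ : Set (HeightOneSpectrum (𝓞 K)), S₀.Finite ∧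
      ∀ {S : Set (HeightOneSpectrum (𝓞 K))} (_hS : S.Finite) (_hS₀ : S₀ ⊆ S)
        {α β : SatakeFamily K} (_hα : ∀ w ∉ S, π₁.1.HasSatakeParamAt w (α w))
        (_hβ : ∀ w ∉ S, π₂.1.HasSatakeParamAt w (β w))
        (_hu : ∀ w ∉ S, ‖(α w).prod‖ = 1) (_hu' : ∀ w ∉ S, ‖(β w).prod‖ = 1)
        {z : ℂ} (_hz : 1 ≤ z.re),
        ∃ (e : ℕ) (c : ℂ), c ≠ 0 ∧ (a ≠ b → e = 0) ∧
          Tendsto (fun t : ℝ => (t : ℂ) ^ e * partialPairL S α β (z + t)) (𝓝[>] (0 : ℝ)) (𝓝 c) := by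
  haveI : NeZero a := ⟨ha.ne'⟩
  haveI : NeZero b := ⟨hb.ne'⟩
  obtain ⟨Sc, hSc, hcont⟩ := continuousAt_and_ne_zero_partialPairL_repData π₁ π₂
  obtain ⟨Sb, hSb, hbd⟩ := hJSb a b K h₁ h₂ ha hb π₁ π₂
  -- the interior case, common to both branches
  have interior : ∀ {S : Set (HeightOneSpectrum (𝓞 K))} (_ : S.Finite) (_ : Sc ⊆ S)
      {α β : SatakeFamily K} (_ : ∀ w ∉ S, π₁.1.HasSatakeParamAt w (α w))
      (_ : ∀ w ∉ S, π₂.1.HasSatakeParamAt w (β w))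
      (_ : ∀ w ∉ S, ‖(α w).prod‖ = 1) (_ : ∀ w ∉ S, ‖(β w).prod‖ = 1) {z : ℂ} (_ : 1 < z.re),
      ∃ (e : ℕ) (c : ℂ), c ≠ 0 ∧ (a ≠ b → e = 0) ∧
        Tendsto (fun t : ℝ => (t : ℂ) ^ e * partialPairL S α β (z + t)) (𝓝[>] (0 : ℝ)) (𝓝 c) := by
    intro S hS hScS α β hα hβ hu hu' z hz
    obtain ⟨hca, hne⟩ := hcont hS hScS hα hβ hu hu' hz
    refine ⟨0, _, hne, fun _ => rfl, ?_⟩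
    simp only [pow_zero, one_mul]
    exact hca.tendsto.comp ((tendsto_ofReal_add_nhdsWithin hz.le).mono_right nhdsWithin_le_nhds)
  by_cases hab : a = b
  · subst hab
    obtain ⟨Sp, hSp, hpl⟩ := hJSp a K h₁ ha π₁ π₂
    refine ⟨Sc ∪ Sb ∪ Sp, (hSc.union hSb).union hSp, ?_⟩
    intro S hS hS₀ α β hα hβ hu hu' z hz
    rcases hz.lt_or_eq with hlt | heq
    · exact interior hS (fun x hx => hS₀ (Or.inl (Or.inl hx))) hα hβ hu hu' hlt
    · by_cases hX : ∀ᶠ w : HeightOneSpectrum (𝓞 K) in cofinite,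
          (α w).map ((((w.residueCard : ℂ) ^ (1 - z))) * ·) = (β w).map (·⁻¹)
      · obtain ⟨c, hc, ht⟩ := hpl hS (fun x hx => hS₀ (Or.inr hx)) hα hβ hu hu' heq.symm hX
        refine ⟨1, c, hc, fun h => (h rfl).elim, ?_⟩
        have := ht.comp (tendsto_ofReal_add_nhdsWithin hz)
        simpa only [Function.comp_def, pow_one, add_sub_cancel_left] using this
      · obtain ⟨c, hc, ht⟩ :=
          hbd hS (fun x hx => hS₀ (Or.inl (Or.inr hx))) hα hβ hu hu' heq.symm (fun h => hX h.2)
        refine ⟨0, c, hc, fun _ => rfl, ?_⟩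
        simpa only [Function.comp_def, pow_zero, one_mul] using
          ht.comp (tendsto_ofReal_add_nhdsWithin hz)
  · refine ⟨Sc ∪ Sb, hSc.union hSb, ?_⟩
    intro S hS hS₀ α β hα hβ hu hu' z hz
    rcases hz.lt_or_eq with hlt | heq
    · exact interior hS (fun x hx => hS₀ (Or.inl hx)) hα hβ hu hu' hlt
    · obtain ⟨c, hc, ht⟩ :=
        hbd hS (fun x hx => hS₀ (Or.inr hx)) hα hβ hu hu' heq.symm (fun h => hab h.1)
      refine ⟨0, c, hc, fun _ => rfl, ?_⟩
      simpa only [Function.comp_def, pow_zero, one_mul] using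
        ht.comp (tendsto_ofReal_add_nhdsWithin hz)

/-- **The self-dual factor has a simple pole at `s = 1`.**  For cuspidal Borel–Jacquet data `π₁`,
`π₂` on `GL_a` with unitary Satake families `α` and `β = α⁻¹` off `S` (the Hecke matrices of `π`
and its contragredient), `t · L^S(1 + t, α ⊗ α⁻¹)` has a finite non-zero limit as `t → 0⁺`: (2.3)
(hypothesis `hJSp`) at `s₀ = 1 ∈ X`. [cite: ArthurClozelAMS120, Ch. 3 §2 (2.3)] -/
theorem exists_tendsto_ofReal_mul_partialPairL_dual
    (hJSp : JacquetShalika1981_partialPairL_pole_repData)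
    {a : ℕ} (ha : 0 < a) {h₁ : isCompact_glFiniteIntegralLevel a K}
    (π₁ π₂ : CuspidalAutomorphicRepData a K h₁) :
    ∃ S₀ : Set (HeightOneSpectrum (𝓞 K)), S₀.Finite ∧
      ∀ {S : Set (HeightOneSpectrum (𝓞 K))} (_hS : S.Finite) (_hS₀ : S₀ ⊆ S)
        {α β : SatakeFamily K} (_hα : ∀ w ∉ S, π₁.1.HasSatakeParamAt w (α w))
        (_hβ : ∀ w ∉ S, π₂.1.HasSatakeParamAt w (β w))
        (_hu : ∀ w ∉ S, ‖(α w).prod‖ = 1) (_hu' : ∀ w ∉ S, ‖(β w).prod‖ = 1)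
        (_hdual : ∀ w ∉ S, β w = (α w).map (·⁻¹)),
        ∃ c : ℂ, c ≠ 0 ∧
          Tendsto (fun t : ℝ => (t : ℂ) * partialPairL S α β (1 + t)) (𝓝[>] (0 : ℝ)) (𝓝 c) := by
  obtain ⟨Sp, hSp, hpl⟩ := hJSp a K h₁ ha π₁ π₂
  refine ⟨Sp, hSp, ?_⟩
  intro S hS hS₀ α β hα hβ hu hu' hdual
  have hX : ∀ᶠ w : HeightOneSpectrum (𝓞 K) in cofinite,
      (α w).map ((((w.residueCard : ℂ) ^ (1 - (1 : ℂ)))) * ·) = (β w).map (·⁻¹) := by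
    filter_upwards [hS.eventually_cofinite_notMem] with w hw
    rw [hdual w hw, Multiset.map_map, sub_self, Complex.cpow_zero]
    simp only [one_mul, Function.comp_def, inv_inv, Multiset.map_id']
  obtain ⟨c, hc, ht⟩ := hpl hS hS₀ hα hβ hu hu' Complex.one_re hX
  refine ⟨c, hc, ?_⟩
  have := ht.comp (tendsto_ofReal_add_nhdsWithin (z := (1 : ℂ)) (by simp))
  simpa only [Function.comp_def, add_sub_cancel_left] using this

end Limits

/-! ### Bookkeeping on multisets and exponents -/

section Bookkeeping

/-- `(c • entrywise) ∑ᵢ βᵢ = ∑ᵢ (c • entrywise) βᵢ` for finite sums of multisets. [folklore] -/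
theorem multiset_map_mul_sum {ι : Type*} (s : Finset ι) (β : ι → Multiset ℂ) (c : ℂ) :
    (∑ i ∈ s, β i).map (c * ·) = ∑ i ∈ s, (β i).map (c * ·) :=
  map_sum (Multiset.mapAddMonoidHom (c * ·)) β s

/-- From `∏ᵢ q^{mᵢ yᵢ} = 1` (`q > 1`, reals `yᵢ`): `∑ᵢ mᵢ yᵢ = 0`. [folklore] -/
theorem sum_mul_eq_zero_of_prod_rpow_eq_one {ι : Type*} (s : Finset ι) (m : ι → ℕ) (y : ι → ℝ)
    {q : ℝ} (hq : 1 < q) (h : ∏ i ∈ s, (q ^ y i) ^ m i = 1) : ∑ i ∈ s, (m i : ℝ) * y i = 0 := by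
  have hq0 : 0 < q := lt_trans zero_lt_one hq
  have hlog := congrArg Real.log h
  rw [Real.log_one, Real.log_prod] at hlog
  · have : ∑ i ∈ s, (m i : ℝ) * y i * Real.log q = 0 := by
      rw [← hlog]
      refine Finset.sum_congr rfl fun i _ => ?_
      rw [Real.log_pow, Real.log_rpow hq0]
      ring
    rw [← Finset.sum_mul] at this
    exact (mul_eq_zero.mp this).resolve_right (Real.log_pos hq).ne'
  · intro i _
    exact pow_ne_zero _ (Real.rpow_pos_of_pos hq0 _).ne'

end Bookkeeping

/-! ### Isobaric rigidity -/

section Rigidity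

variable {K : Type} [Field K] [NumberField K]

/-- **Isobaric rigidity at unramified places (Jacquet–Shalika II, Thm. 4.4, for Borel–Jacquet
data), from Arthur–Clozel (2.2)–(2.3).**  For a cuspidal `π` on `GL_n(𝔸_K)` (`n ≥ 1`) and cuspidal
`σ_i` on `GL_{m_i}(𝔸_K)` (`i < k`, `k ≥ 2`, `m_i ≥ 1`), it is not true that at almost every place every
Satake parameter of `π` is a sum `∑_i β_i` of Satake parameters `β_i` of the `σ_i`.  Hypotheses: the
named facts `JacquetShalika1981_partialPairL_boundary_repData` ((2.2)) and
`JacquetShalika1981_partialPairL_pole_repData` ((2.3)); proof in the module docstring.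
[cite: JacquetShalikaAJM1981II, Thm. 4.4] [cite: ArthurClozelAMS120, Ch. 3, proof of Thm. 4.2 (d), pp. 206–207] -/
theorem CuspidalAutomorphicRepData.not_eventually_satake_eq_sum_of_JS
    (hJSb : JacquetShalika1981_partialPairL_boundary_repData)
    (hJSp : JacquetShalika1981_partialPairL_pole_repData)
    {n : ℕ} {hcpt : isCompact_glFiniteIntegralLevel n K} (π : CuspidalAutomorphicRepData n K hcpt)
    {k : ℕ} {m : Fin k → ℕ} {hm : ∀ i, isCompact_glFiniteIntegralLevel (m i) K}
    (σ : ∀ i, CuspidalAutomorphicRepData (m i) K (hm i)) (hn : 0 < n) (hk : 2 ≤ k)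
    (hm0 : ∀ i, 0 < m i) :
    ¬ ∀ᶠ v : HeightOneSpectrum (𝓞 K) in cofinite, ∀ α : Multiset ℂ, π.1.HasSatakeParamAt v α →
        ∃ β : Fin k → Multiset ℂ, (∀ i, (σ i).1.HasSatakeParamAt v (β i)) ∧ α = ∑ i, β i := by
  intro H
  -- notation for residue cardinalities
  have hq1 : ∀ w : HeightOneSpectrum (𝓞 K), (1 : ℝ) < (w.residueCard : ℝ) := fun w => by
    exact_mod_cast w.one_lt_residueCard
  have hq0 : ∀ w : HeightOneSpectrum (𝓞 K), ((w.residueCard : ℕ) : ℂ) ≠ 0 := fun w =>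
    Nat.cast_ne_zero.mpr (zero_lt_one.trans w.one_lt_residueCard).ne'
  -- Step 1: unitary avatars of `π` and of the `σ i`
  haveI : NeZero n := ⟨hn.ne'⟩
  obtain ⟨s₀, Sπ, α₀, πu, hSπ, hiff₀, hπu, hu₀, hcard₀⟩ := π.exists_unitary_avatar hcpt
  have hav : ∀ i, ∃ (s : ℂ) (S : Set (HeightOneSpectrum (𝓞 K))) (α : SatakeFamily K)
      (σu : CuspidalAutomorphicRepData (m i) K (hm i)), S.Finite ∧
      (∀ w ∉ S, ∀ β : Multiset ℂ,
        (σ i).1.HasSatakeParamAt w β ↔ β = (α w).map (((w.residueCard : ℂ) ^ s) * ·)) ∧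
      (∀ w ∉ S, σu.1.HasSatakeParamAt w (α w)) ∧
      (∀ w ∉ S, ‖(α w).prod‖ = 1) ∧ (∀ w ∉ S, Multiset.card (α w) = m i) := fun i => by
    haveI : NeZero (m i) := ⟨(hm0 i).ne'⟩
    exact (σ i).exists_unitary_avatar (hm i)
  choose s S α σu hSfin hiff hσu hu hcard using hav
  -- Step 2: the exceptional set of the hypothesis and the normalised isobaric relation
  obtain ⟨T, hTfin, hT⟩ : ∃ T : Set (HeightOneSpectrum (𝓞 K)), T.Finite ∧ ∀ v ∉ T,
      ∀ a : Multiset ℂ, π.1.HasSatakeParamAt v a →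
        ∃ β : Fin k → Multiset ℂ, (∀ i, (σ i).1.HasSatakeParamAt v (β i)) ∧ a = ∑ i, β i := by
    rw [Filter.eventually_cofinite] at H
    exact ⟨_, H, fun v hv => not_not.mp hv⟩
  set S₁ : Set (HeightOneSpectrum (𝓞 K)) := Sπ ∪ T ∪ ⋃ i, S i with hS₁def
  have hS₁fin : S₁.Finite := (hSπ.union hTfin).union (Set.finite_iUnion hSfin)
  have hS₁π : ∀ w ∉ S₁, w ∉ Sπ := fun w hw h => hw (Or.inl (Or.inl h))
  have hS₁T : ∀ w ∉ S₁, w ∉ T := fun w hw h => hw (Or.inl (Or.inr h))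
  have hS₁i : ∀ w ∉ S₁, ∀ i, w ∉ S i := fun w hw i h => hw (Or.inr (Set.mem_iUnion.mpr ⟨i, h⟩))
  -- `q^{s₀} α₀(w) = ∑ i, q^{s i} α i (w)` off `S₁`
  have hrel : ∀ w ∉ S₁, (α₀ w).map ((((w.residueCard : ℂ) ^ s₀)) * ·) =
      ∑ i, (α i w).map ((((w.residueCard : ℂ) ^ s i)) * ·) := by
    intro w hw
    have h1 : π.1.HasSatakeParamAt w ((α₀ w).map ((((w.residueCard : ℂ) ^ s₀)) * ·)) :=
      (hiff₀ w (hS₁π w hw) _).2 rfl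
    obtain ⟨β, hβ, hsum⟩ := hT w (hS₁T w hw) _ h1
    rw [hsum]
    exact Finset.sum_congr rfl fun i _ => (hiff i w (hS₁i w hw i) (β i)).1 (hβ i)
  -- `α₀(w) = ∑ i, q^{s i - s₀} α i (w)` off `S₁`
  have hrel' : ∀ w ∉ S₁,
      α₀ w = ∑ i, (α i w).map ((((w.residueCard : ℂ) ^ (s i - s₀))) * ·) := by
    intro w hw
    have h := congrArg (Multiset.map ((((w.residueCard : ℂ) ^ (-s₀))) * ·)) (hrel w hw)
    rw [Multiset.map_map, multiset_map_mul_sum] at h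
    have hL : ((fun x => (w.residueCard : ℂ) ^ (-s₀) * x) ∘ fun x => (w.residueCard : ℂ) ^ s₀ * x) =
        id := by
      funext x
      simp only [Function.comp_apply, id_eq, ← mul_assoc, ← Complex.cpow_add _ _ (hq0 w),
        neg_add_cancel, Complex.cpow_zero, one_mul]
    rw [hL, Multiset.map_id] at h
    rw [h]
    refine Finset.sum_congr rfl fun i _ => ?_
    rw [Multiset.map_map]
    refine Multiset.map_congr rfl fun x _ => ?_
    simp only [Function.comp_apply, ← mul_assoc, ← Complex.cpow_add _ _ (hq0 w)]
    congr 2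
    ring
  -- Step 3: one good place; ranks and exponents
  haveI := infinite_heightOneSpectrum' K
  obtain ⟨w₀, -, hw₀⟩ := ((Set.infinite_univ (α := HeightOneSpectrum (𝓞 K))).sdiff hS₁fin).nonempty
  have hnsum : n = ∑ i, m i := by
    have h := congrArg Multiset.card (hrel w₀ hw₀)
    rw [Multiset.card_map, hcard₀ w₀ (hS₁π w₀ hw₀), Multiset.card_sum] at h
    rw [h]
    exact Finset.sum_congr rfl fun i _ => by rw [Multiset.card_map, hcard i w₀ (hS₁i w₀ hw₀ i)]
  -- the exponent identity `∑ i, m i (Re s i - Re s₀) = 0`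
  have hexp : ∑ i, (m i : ℝ) * ((s i).re - s₀.re) = 0 := by
    have h : ‖(α₀ w₀).prod‖ =
        ‖(∑ i, (α i w₀).map ((((w₀.residueCard : ℂ) ^ (s i - s₀))) * ·)).prod‖ :=
      congrArg (fun M : Multiset ℂ => ‖M.prod‖) (hrel' w₀ hw₀)
    rw [hu₀ w₀ (hS₁π w₀ hw₀), Multiset.prod_sum, norm_prod] at h
    refine sum_mul_eq_zero_of_prod_rpow_eq_one Finset.univ m _ (hq1 w₀) ?_
    rw [h]
    refine Finset.prod_congr rfl fun i _ => ?_
    rw [prod_map_const_mul_eq, hcard i w₀ (hS₁i w₀ hw₀ i), norm_mul, norm_pow,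
      hu i w₀ (hS₁i w₀ hw₀ i), mul_one,
      Complex.norm_natCast_cpow_of_pos (zero_lt_one.trans w₀.one_lt_residueCard), Complex.sub_re]
  -- `i₀` with maximal real twist exponent; then `Re s₀ ≤ Re s i₀` and `n ≠ m i₀`
  have hk0 : 0 < k := by omega
  obtain ⟨i₀, -, hi₀⟩ :=
    Finset.exists_max_image Finset.univ (fun i => (s i).re) ⟨⟨0, hk0⟩, Finset.mem_univ _⟩
  have hx₀ : s₀.re ≤ (s i₀).re := by
    by_contra hlt
    push Not at hlt
    have hneg : ∑ i, (m i : ℝ) * ((s i).re - s₀.re) < 0 := by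
      refine Finset.sum_neg (fun i _ => mul_neg_of_pos_of_neg (by exact_mod_cast hm0 i) ?_)
        ⟨i₀, Finset.mem_univ _⟩
      linarith [hi₀ i (Finset.mem_univ _)]
    exact hneg.ne hexp
  have hnm : n ≠ m i₀ := by
    obtain ⟨j, hj⟩ : ∃ j : Fin k, j ≠ i₀ := by
      by_cases h0 : i₀ = ⟨0, hk0⟩
      · exact ⟨⟨1, by omega⟩, fun h => by simp [h0, Fin.ext_iff] at h⟩
      · exact ⟨⟨0, hk0⟩, fun h => h0 h.symm⟩
    have hle : m i₀ + m j ≤ ∑ i, m i := by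
      rw [← Finset.add_sum_erase Finset.univ m (Finset.mem_univ i₀)]
      exact Nat.add_le_add_left
        (Finset.single_le_sum (fun i _ => Nat.zero_le (m i)) (Finset.mem_erase.mpr ⟨hj, Finset.mem_univ _⟩)) _
    have := hm0 j
    omega
  -- Step 4: the contragredient `τ` of `σu i₀`, with the unitary family `α i₀ ⁻¹`
  obtain ⟨τ, hτ⟩ := CuspidalAutomorphicRepData.exists_contragredient_satake_holds (hm i₀) (σu i₀)
  set αd : SatakeFamily K := fun w => (α i₀ w).map (·⁻¹) with hαd
  have hτd : ∀ w ∉ S₁, τ.1.HasSatakeParamAt w (αd w) := fun w hw =>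
    hτ w _ (hσu i₀ w (hS₁i w hw i₀))
  have hud : ∀ w ∉ S₁, ‖(αd w).prod‖ = 1 := fun w hw => by
    simp only [hαd]
    rw [Multiset.prod_map_inv', norm_inv, hu i₀ w (hS₁i w hw i₀), inv_one]
  -- Step 5: the finite set `S` absorbing every `S₀` of the analytic inputs
  have hA : ∀ i, ∃ S₀ : Set (HeightOneSpectrum (𝓞 K)), S₀.Finite ∧
      ∀ {S' : Set (HeightOneSpectrum (𝓞 K))} (_hS : S'.Finite) (_hS₀ : S₀ ⊆ S')
        {α' β' : SatakeFamily K} (_hα : ∀ w ∉ S', (σu i).1.HasSatakeParamAt w (α' w))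
        (_hβ : ∀ w ∉ S', τ.1.HasSatakeParamAt w (β' w))
        (_hu : ∀ w ∉ S', ‖(α' w).prod‖ = 1) (_hu' : ∀ w ∉ S', ‖(β' w).prod‖ = 1)
        {z : ℂ} (_hz : 1 ≤ z.re),
        ∃ (e : ℕ) (c : ℂ), c ≠ 0 ∧ (m i ≠ m i₀ → e = 0) ∧
          Tendsto (fun t : ℝ => (t : ℂ) ^ e * partialPairL S' α' β' (z + t)) (𝓝[>] (0 : ℝ))
            (𝓝 c) := fun i =>
    exists_tendsto_pow_mul_partialPairL_ofReal_add hJSb hJSp (hm0 i) (hm0 i₀) (σu i) τ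
  choose SA hSAfin hSA using hA
  obtain ⟨SB, hSBfin, hSB⟩ := exists_tendsto_ofReal_mul_partialPairL_dual hJSp (hm0 i₀) (σu i₀) τ
  obtain ⟨SL, hSLfin, hSL⟩ :=
    exists_tendsto_pow_mul_partialPairL_ofReal_add hJSb hJSp hn (hm0 i₀) πu τ
  have h21 : ∀ i, ∃ S₀ : Set (HeightOneSpectrum (𝓞 K)), S₀.Finite ∧
      ∀ {S' : Set (HeightOneSpectrum (𝓞 K))} (_hS : S'.Finite) (_hS₀ : S₀ ⊆ S')
        {α' β' : SatakeFamily K} (_hα : ∀ w ∉ S', (σu i).1.HasSatakeParamAt w (α' w))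
        (_hβ : ∀ w ∉ S', τ.1.HasSatakeParamAt w (β' w))
        (_hu : ∀ w ∉ S', ‖(α' w).prod‖ = 1) (_hu' : ∀ w ∉ S', ‖(β' w).prod‖ = 1)
        {z : ℂ} (_hs : 1 < z.re),
        Multipliable fun v : {v : HeightOneSpectrum (𝓞 K) // v ∉ S'} =>
          ((satakePairPolynomial (α' v.1) (β' v.1)).eval ((v.1.residueCard : ℂ) ^ (-z)))⁻¹ :=
    fun i => JacquetShalika1981_multipliable_partialPairL_repData_holds (m i) (m i₀) K (hm i)
      (hm i₀) (hm0 i) (hm0 i₀) (σu i) τ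
  choose S2 hS2fin hS2 using h21
  set S : Set (HeightOneSpectrum (𝓞 K)) := S₁ ∪ (SL ∪ (SB ∪ ((⋃ i, SA i) ∪ ⋃ i, S2 i)))
    with hSdef
  have hSfin : S.Finite :=
    hS₁fin.union (hSLfin.union (hSBfin.union ((Set.finite_iUnion hSAfin).union
      (Set.finite_iUnion hS2fin))))
  have hS₁S : S₁ ⊆ S := Set.subset_union_left
  have hSLS : SL ⊆ S := Set.subset_union_left.trans Set.subset_union_right
  have hSBS : SB ⊆ S :=
    (Set.subset_union_left.trans Set.subset_union_right).trans Set.subset_union_right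
  have hSAS : ∀ i, SA i ⊆ S := fun i =>
    (((Set.subset_iUnion SA i).trans Set.subset_union_left).trans Set.subset_union_right).trans
      (Set.subset_union_right.trans Set.subset_union_right)
  have hS2S : ∀ i, S2 i ⊆ S := fun i =>
    (((Set.subset_iUnion S2 i).trans Set.subset_union_right).trans Set.subset_union_right).trans
      (Set.subset_union_right.trans Set.subset_union_right)
  have hnot₁ : ∀ w ∉ S, w ∉ S₁ := fun w hw h => hw (hS₁S h)
  -- the families off `S`
  have hαS : ∀ i, ∀ w ∉ S, (σu i).1.HasSatakeParamAt w (α i w) := fun i w hw =>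
    hσu i w (hS₁i w (hnot₁ w hw) i)
  have huS : ∀ i, ∀ w ∉ S, ‖(α i w).prod‖ = 1 := fun i w hw => hu i w (hS₁i w (hnot₁ w hw) i)
  have hτS : ∀ w ∉ S, τ.1.HasSatakeParamAt w (αd w) := fun w hw => hτd w (hnot₁ w hw)
  have hudS : ∀ w ∉ S, ‖(αd w).prod‖ = 1 := fun w hw => hud w (hnot₁ w hw)
  have hπuS : ∀ w ∉ S, πu.1.HasSatakeParamAt w (α₀ w) := fun w hw => hπu w (hS₁π w (hnot₁ w hw))
  have hu₀S : ∀ w ∉ S, ‖(α₀ w).prod‖ = 1 := fun w hw => hu₀ w (hS₁π w (hnot₁ w hw))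
  -- Step 6: the points `u₀ = 1 - s₀ + s i₀`, `z i = 1 + s i₀ - s i` (all with `Re ≥ 1`)
  set u₀ : ℂ := 1 - s₀ + s i₀ with hu₀def
  set z : Fin k → ℂ := fun i => 1 + s i₀ - s i with hzdef
  have hu₀re : 1 ≤ u₀.re := by
    simp only [hu₀def, Complex.add_re, Complex.sub_re, Complex.one_re]
    linarith
  have hzre : ∀ i, 1 ≤ (z i).re := fun i => by
    simp only [hzdef, Complex.add_re, Complex.sub_re, Complex.one_re]
    linarith [hi₀ i (Finset.mem_univ _)]
  have hzi₀ : z i₀ = 1 := by simp [hzdef]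
  -- Step 7: limits of the factors
  have hfac : ∀ i, ∃ (e : ℕ) (c : ℂ), c ≠ 0 ∧ (i = i₀ → e = 1) ∧
      Tendsto (fun t : ℝ => (t : ℂ) ^ e * partialPairL S (α i) αd (z i + t)) (𝓝[>] (0 : ℝ))
        (𝓝 c) := by
    intro i
    by_cases hi : i = i₀
    · subst hi
      obtain ⟨c, hc, ht⟩ := hSB hSfin hSBS (hαS i) hτS (huS i) hudS (fun w _ => rfl)
      refine ⟨1, c, hc, fun _ => rfl, ?_⟩
      simpa only [hzi₀, pow_one] using ht
    · obtain ⟨e, c, hc, -, ht⟩ := hSA i hSfin (hSAS i) (hαS i) hτS (huS i) hudS (hzre i)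
      exact ⟨e, c, hc, fun h => (hi h).elim, ht⟩
  choose e c hc hei₀ hF using hfac
  -- the left-hand side has a finite limit
  obtain ⟨eL, cL, -, heL, hG⟩ := hSL hSfin hSLS hπuS hτS hu₀S hudS hu₀re
  have heL0 : eL = 0 := heL hnm
  -- Step 8: the Euler-product identity for real `t > 0`
  have hident : ∀ t : ℝ, 0 < t →
      partialPairL S α₀ αd (u₀ + t) = ∏ i, partialPairL S (α i) αd (z i + t) := by
    intro t ht
    have hmul : ∀ i, Multipliable fun v : {v : HeightOneSpectrum (𝓞 K) // v ∉ S} =>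
        ((satakePairPolynomial (α i v.1) (αd v.1)).eval
          ((v.1.residueCard : ℂ) ^ (-(z i + t))))⁻¹ := fun i =>
      hS2 i hSfin (hS2S i) (hαS i) hτS (huS i) hudS (z := z i + t)
        (by simp only [Complex.add_re, Complex.ofReal_re]; linarith [hzre i])
    have hloc : ∀ v : {v : HeightOneSpectrum (𝓞 K) // v ∉ S},
        ((satakePairPolynomial (α₀ v.1) (αd v.1)).eval ((v.1.residueCard : ℂ) ^ (-(u₀ + t))))⁻¹ =
          ∏ i, ((satakePairPolynomial (α i v.1) (αd v.1)).eval
            ((v.1.residueCard : ℂ) ^ (-(z i + t))))⁻¹ := by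
      intro v
      rw [hrel' v.1 (hnot₁ v.1 v.2), satakePairPolynomial_sum_left, Polynomial.eval_prod,
        ← Finset.prod_inv_distrib]
      refine Finset.prod_congr rfl fun i _ => ?_
      rw [eval_satakePairPolynomial_map_mul_left, ← Complex.cpow_add _ _ (hq0 v.1)]
      congr 3
      simp only [hzdef, hu₀def]
      ring
    simp only [partialPairL]
    rw [tprod_congr hloc]
    exact Multipliable.tprod_finsetProd fun i _ => hmul i
  -- Step 9: the contradiction
  set E : ℕ := ∑ i, e i with hEdef
  have hE : 1 ≤ E := by
    rw [hEdef, ← hei₀ i₀ rfl]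
    exact Finset.single_le_sum (fun i _ => Nat.zero_le (e i)) (Finset.mem_univ i₀)
  have hC : (∏ i, c i) ≠ 0 := Finset.prod_ne_zero_iff.mpr fun i _ => hc i
  -- `t^E · RHS → ∏ c i ≠ 0`
  have hR : Tendsto (fun t : ℝ => (t : ℂ) ^ E * ∏ i, partialPairL S (α i) αd (z i + t))
      (𝓝[>] (0 : ℝ)) (𝓝 (∏ i, c i)) := by
    have h := tendsto_finsetProd Finset.univ fun i (_ : i ∈ Finset.univ) => hF i
    refine h.congr fun t => ?_
    rw [Finset.prod_mul_distrib, Finset.prod_pow_eq_pow_sum]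
  -- `t^E · LHS → 0`
  have hL : Tendsto (fun t : ℝ => (t : ℂ) ^ E * partialPairL S α₀ αd (u₀ + t))
      (𝓝[>] (0 : ℝ)) (𝓝 0) := by
    have h0 : Tendsto (fun t : ℝ => (t : ℂ) ^ E) (𝓝[>] (0 : ℝ)) (𝓝 0) := by
      have : Tendsto (fun t : ℝ => (t : ℂ)) (𝓝[>] (0 : ℝ)) (𝓝 0) := by
        have h := (Complex.continuous_ofReal.tendsto (0 : ℝ)).mono_left
          (nhdsWithin_le_nhds (s := Set.Ioi (0 : ℝ)))
        simpa using h
      simpa [zero_pow (by omega : E ≠ 0)] using this.pow E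
    have hG' : Tendsto (fun t : ℝ => partialPairL S α₀ αd (u₀ + t)) (𝓝[>] (0 : ℝ)) (𝓝 cL) := by
      simpa only [heL0, pow_zero, one_mul] using hG
    simpa using h0.mul hG'
  have hL' : Tendsto (fun t : ℝ => (t : ℂ) ^ E * ∏ i, partialPairL S (α i) αd (z i + t))
      (𝓝[>] (0 : ℝ)) (𝓝 0) := by
    refine hL.congr' ?_
    filter_upwards [self_mem_nhdsWithin] with t ht
    rw [hident t ht]
  exact hC (tendsto_nhds_unique hR hL')

end Rigidity

end Literature.NumberTheory.Automorphic

end
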